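import Summits.FinalStateConjecture.FinalStateConjecture.Theorems.HonestFixedRadiusSettling.Negative.KillShape
import Summits.FinalStateConjecture.FinalStateConjecture.Theorems.SwallowTheDatumUniversalWitnessFamilyStubDecompositionPushforward
import Literature.Geometry.Lorentzian.ConvergenceTransport
import HarnessLib

/-!
# Crux `StarvedNecks.HonestFixedRadiusSettling` (stmt-FinalStateConjecture-13550), line
# `far-field-surgery` (reshape v6, sheet burial), stub `stub_honestPushforward`

**Honest final-state decompositions push forward along isometric open embeddings of
spacetimes.**  Let `χ : 𝓢 → 𝓢'` be smooth, an open embedding, an isometric immersion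
(`χ^* g' = g`) and time-orientation preserving, and let `d` be a `Cᵏ` final-state decomposition
of `O ⊆ 𝓢` lying in `honestCoreSet ∩ honestFarSet` at radius `R₀` (the crux's let-bound clauses
C1–C4, F1–F3, read back as sets in `Negative.KillShape`).  Assume moreover NO ESCAPE of the far
flat slabs: `closure (χ(Φ(far slab τ'))) ⊆ range χ` for every `τ' > τ₀`.  Then `χ_* d` — the
same holes, masses, spins, motions, `τ₀`, excision radii and flat domain, with the charts
`χ ∘ chartᵢ`, `χ ∘ flatChart` (verbatim the landed
`SwallowTheDatum.UniversalWitnessFamily.stub_decompositionPushforward`, at order `k`) — is a `Cᵏ`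
decomposition of `χ(O)` with charted region `χ(d.charted)`, again in
`honestCoreSet ∩ honestFarSet` at `R₀`.

Clause by clause (pure bookkeeping over the landed transport lemmas):

* C1 — identical data;
* C2 / F1 — `(χ ∘ Ψ)(S) = χ(Ψ(S)) ⊆ χ(J⁻(Ψ(T))) ⊆ J⁻(χ(Ψ(T)))`
  (`LorentzianMetric.image_causalPast_subset`);
* C3 — relative closures commute with the embedding `χ`:
  `closure A = χ⁻¹(closure (χ A))` (`Topology.IsInducing.closure_eq_preimage_closure_image`),
  so `closure (χ A) ∩ χ O ⊆ χ A` follows from `closure A ∩ O ⊆ A`;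
* C4 — chain rule `d(χ ∘ Φ)_y = dχ_{Φ y} ∘ dΦ_y` (`mfderiv_comp`) and
  `TimeOrientation.PreservesTimeOrientation.isFutureDirected_mfderiv` (the differential of a
  time-orientation preserving isometric immersion maps future-directed vectors to future-directed
  vectors);
* F2 — the ABSOLUTE closure `closure (χ(Φ S))` lies in `range χ` by the no-escape hypothesis, hence
  equals `χ(closure (Φ S)) ⊆ χ(Φ S')`;
* F3 — the deviation functions are IDENTICAL, `(χ ∘ Ψ)^* g' − g₀ = Ψ^* g − g₀`
  (`deviationExtend_comp`), so the same late time `T` works verbatim.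

References: B. O'Neill, *Semi-Riemannian geometry* (1983), Ch. 3, p. 58 and pp. 90–91 (pullbacks,
local isometries), Ch. 5, p. 145 (timecones), Ch. 14, pp. 402–403 (causal relations under maps);
M. Dafermos, J. Luk, arXiv:1710.01722, Conjecture 1; DHRT arXiv:2104.08222, §1 (consequence form
of convergence, as vendored in `KerrConvergence`).
-/

set_option linter.dupNamespace false

noncomputable section

open scoped Manifold ContDiff Topology
open Set Filter Function Literature.Geometry.Lorentzian
open Summit.FinalStateConjecture.FinalStateConjecture.Theorems.HonestFixedRadiusSettling.Negative
  (honestCoreSet honestFarSet)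
open Summit.FinalStateConjecture.FinalStateConjecture.Theorems.SwallowTheDatum.UniversalWitnessFamily
  (isLateChart_comp deviationExtend_comp deviationCk_comp truncDeviationCk_comp
    image_diff_subset_causalPast_image pairwise_disjoint_image_comp)

namespace Summit.FinalStateConjecture.FinalStateConjecture.Theorems.StarvedNecks.SheetBurial

/-! ## Transport of the honest clauses along `χ` -/

section Transport

variable {𝓢 𝓢' : Spacetime.{0} 4} {χ : 𝓢.carrier → 𝓢'.carrier}

/-- **Clauses C2 / F1 push forward**: if `Ψ(S) ⊆ J⁻(Ψ(T))` in `𝓢` and `χ : 𝓢 → 𝓢'` is a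
differentiable, time-orientation preserving isometric immersion, then
`(χ ∘ Ψ)(S) = χ(Ψ(S)) ⊆ χ(J⁻(Ψ(T))) ⊆ J⁻((χ ∘ Ψ)(T))` in `𝓢'`
(`LorentzianMetric.image_causalPast_subset`). O'Neill 1983, Ch. 14, p. 403. -/
theorem image_comp_subset_causalPast_image_comp (hχd : MDifferentiable (𝓡 4) (𝓡 4) χ)
    (hτ : 𝓢.timeOrientation.PreservesTimeOrientation χ 𝓢'.timeOrientation)
    (hφ : ∀ y, pullbackBilin (I := 𝓡 4) (I' := 𝓡 4) χ 𝓢'.metric.val y = 𝓢.metric.val y)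
    {α : Type*} {Ψ : α → 𝓢.carrier} {S T : Set α}
    (h : Ψ '' S ⊆ 𝓢.metric.causalPast 𝓢.timeOrientation (Ψ '' T)) :
    (χ ∘ Ψ) '' S ⊆ 𝓢'.metric.causalPast 𝓢'.timeOrientation ((χ ∘ Ψ) '' T) := by
  rw [image_comp, image_comp]
  exact (image_mono h).trans (LorentzianMetric.image_causalPast_subset hχd hτ hφ _)

/-- **Clause C3 pushes forward** (relative closures commute with embeddings): for an embedding
`χ`, `closure A = χ⁻¹(closure (χ A))` (`Topology.IsInducing.closure_eq_preimage_closure_image`),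
so `closure (Ψ S) ∩ O ⊆ Ψ S` gives `closure ((χ ∘ Ψ) S) ∩ χ O ⊆ (χ ∘ Ψ) S`. [folklore] -/
theorem closure_image_comp_inter_image_subset (hχo : Topology.IsOpenEmbedding χ) {α : Type*}
    {Ψ : α → 𝓢.carrier} {S : Set α} {O : Set 𝓢.carrier}
    (h : closure (Ψ '' S) ∩ O ⊆ Ψ '' S) :
    closure ((χ ∘ Ψ) '' S) ∩ χ '' O ⊆ (χ ∘ Ψ) '' S := by
  rw [image_comp]
  rintro _ ⟨hz, x, hx, rfl⟩
  refine ⟨x, h ⟨?_, hx⟩, rfl⟩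
  rw [hχo.isInducing.closure_eq_preimage_closure_image]
  exact hz

/-- **Clause F2 pushes forward under no escape**: for an embedding `χ`, if `closure (Φ S) ⊆ Φ S'`
and the absolute closure `closure (χ(Φ S))` stays inside `range χ`, then
`closure ((χ ∘ Φ) S) = χ(closure (Φ S)) ⊆ (χ ∘ Φ) S'`
(`Topology.IsInducing.closure_eq_preimage_closure_image`). [folklore] -/
theorem closure_image_comp_subset_of_subset_range (hχo : Topology.IsOpenEmbedding χ)
    {α : Type*} {Φ : α → 𝓢.carrier} {S S' : Set α} (h : closure (Φ '' S) ⊆ Φ '' S')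
    (hr : closure (χ '' (Φ '' S)) ⊆ range χ) :
    closure ((χ ∘ Φ) '' S) ⊆ (χ ∘ Φ) '' S' := by
  rw [image_comp, image_comp]
  intro z hz
  obtain ⟨x, rfl⟩ := hr hz
  refine ⟨x, h ?_, rfl⟩
  rw [hχo.isInducing.closure_eq_preimage_closure_image]
  exact hz

/-- **Clause C4 pushes forward**: by the chain rule `d(χ ∘ Φ)_y v = dχ_{Φ y}(dΦ_y v)`
(`mfderiv_comp`), and the differential of a time-orientation preserving isometric immersion maps
future-directed vectors to future-directed vectors
(`TimeOrientation.PreservesTimeOrientation.isFutureDirected_mfderiv`). O'Neill 1983, Ch. 5,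
p. 145. -/
theorem isFutureDirected_mfderiv_comp (hχd : MDifferentiable (𝓡 4) (𝓡 4) χ)
    (hτ : 𝓢.timeOrientation.PreservesTimeOrientation χ 𝓢'.timeOrientation)
    (hφ : ∀ y, pullbackBilin (I := 𝓡 4) (I' := 𝓡 4) χ 𝓢'.metric.val y = 𝓢.metric.val y)
    {U : TopologicalSpace.Opens E4} {Φ : U → 𝓢.carrier}
    (hΦ : MDifferentiable 𝓘(ℝ, E4) (𝓡 4) Φ) {y : U} {v : TangentSpace 𝓘(ℝ, E4) y}
    (h : 𝓢.timeOrientation.IsFutureDirected (mfderiv 𝓘(ℝ, E4) (𝓡 4) Φ y v)) :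
    𝓢'.timeOrientation.IsFutureDirected (mfderiv 𝓘(ℝ, E4) (𝓡 4) (χ ∘ Φ) y v) := by
  rw [mfderiv_comp y (hχd _) (hΦ y)]
  exact hτ.isFutureDirected_mfderiv hφ h

/-- **Clause F3 pushes forward**: the extended deviation of `χ ∘ Ψ` in `𝓢'` equals that of `Ψ`
in `𝓢` (`deviationExtend_comp`: `(χ ∘ Ψ)^* g' − g₀ = Ψ^* g − g₀`), so every `C⁰` sup-norm
bound transfers verbatim. O'Neill 1983, Ch. 3, p. 58; DHRT arXiv:2104.08222, §1. -/
theorem supCkENorm_deviationExtend_comp_le (B : ModelBackground)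
    (hχd : MDifferentiable (𝓡 4) (𝓡 4) χ)
    (hφ : ∀ y, pullbackBilin (I := 𝓡 4) (I' := 𝓡 4) χ 𝓢'.metric.val y = 𝓢.metric.val y)
    {Ψ : B.domain → 𝓢.carrier} (hΨ : MDifferentiable 𝓘(ℝ, E4) (𝓡 4) Ψ) {s : Set E4} {m : ℕ}
    {c : ENNReal} (h : supCkENorm s m (𝓢.deviationExtend B Ψ) ≤ c) :
    supCkENorm s m (𝓢'.deviationExtend B (χ ∘ Ψ)) ≤ c := by
  rwa [deviationExtend_comp B hχd hφ hΨ]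

end Transport

/-! ## The stub -/

/-- **Stub 6 — `stub_honestPushforward` (HONEST DECOMPOSITIONS PUSH FORWARD ALONG ISOMETRIC OPEN
EMBEDDINGS).**  `χ : 𝓢 → 𝓢'` smooth, open embedding, isometric, time-orientation preserving; `d`
a `Cᵏ` decomposition of `O ⊆ 𝓢` in `honestCoreSet ∩ honestFarSet` at radius `R₀`; and NO ESCAPE
of the far flat slabs (`closure (χ(Φ(far slab τ'))) ⊆ range χ` for every `τ' > τ₀`).  Then
`χ_* d` (same holes, motions, `τ₀`, excision, flat domain; charts `χ ∘ chartᵢ`, `χ ∘ flatChart`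
— verbatim the landed `SwallowTheDatum.UniversalWitnessFamily.stub_decompositionPushforward` at
order `k`) is a `Cᵏ` decomposition of `χ(O)` with charted region `χ(d.charted)`, again in
`honestCoreSet ∩ honestFarSet` at `R₀`: deviations are IDENTICAL (`deviationExtend_comp`), causal
pasts push forward (`LorentzianMetric.image_causalPast_subset`), `d(χ ∘ Φ)(e₀) = dχ(dΦ e₀)` is
future-directed (`PreservesTimeOrientation.isFutureDirected_mfderiv` + chain rule), relative
closures commute with the open embedding (`closure A = χ⁻¹ (closure (χ A))`), and F2 uses the
no-escape hypothesis.
[cite: ONeill1983, Ch. 3, pp. 90–91 and Ch. 14, pp. 402–403] [cite: DafermosLuk2017, Conjecture 1]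
[cite: arXiv210408222, §1] -/
theorem stub_honestPushforward :
    ∀ (𝓢 𝓢' : Spacetime.{0} 4) (χ : 𝓢.carrier → 𝓢'.carrier),
      ContMDiff (𝓡 4) (𝓡 4) ∞ χ → Topology.IsOpenEmbedding χ →
      𝓢.metric.IsIsometricImmersion 𝓢'.metric.toPseudoRiemannianMetric χ →
      𝓢.timeOrientation.PreservesTimeOrientation χ 𝓢'.timeOrientation →
      ∀ (O : Set 𝓢.carrier) (k : ℕ) (d : FinalStateDecomposition 𝓢 O k) (R₀ : ℝ),
        d ∈ honestCoreSet 𝓢 O k R₀ → d ∈ honestFarSet 𝓢 O k R₀ →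
        (∀ τ' : ℝ, d.τ₀ < τ' →
          closure (χ '' (d.flatChart '' {y | τ' ≤ y.1 0 ∧
            ∀ i, d.excision i (y.1 0) + 1 ≤ (d.background i).radius y.1})) ⊆ Set.range χ) →
        ∃ d' : FinalStateDecomposition 𝓢' (χ '' O) k,
          d'.charted = χ '' d.charted ∧
          d' ∈ honestCoreSet 𝓢' (χ '' O) k R₀ ∧ d' ∈ honestFarSet 𝓢' (χ '' O) k R₀ := by
  intro 𝓢 𝓢' χ hχ hχo hiso hτ O k d R₀ hc hf hesc
  obtain ⟨hc1, hc2, hc3, hc4⟩ := hc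
  obtain ⟨hf1, hf2, hf3⟩ := hf
  have hinj : Injective χ := hχo.injective
  have hχd : MDifferentiable (𝓡 4) (𝓡 4) χ := hχ.mdifferentiable (by simp)
  have hφ : ∀ y, pullbackBilin (I := 𝓡 4) (I' := 𝓡 4) χ 𝓢'.metric.val y = 𝓢.metric.val y :=
    hiso.2
  have hΨd : ∀ i, MDifferentiable 𝓘(ℝ, E4) (𝓡 4) (d.chart i) := fun i ↦
    (d.isLateChart i).contMDiff.mdifferentiable (by simp)
  have hΦd : MDifferentiable 𝓘(ℝ, E4) (𝓡 4) d.flatChart :=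
    d.isLateChart_flat.contMDiff.mdifferentiable (by simp)
  -- the pushed-forward decomposition `χ_* d`
  let d' : FinalStateDecomposition 𝓢' (χ '' O) k :=
    { N := d.N
      mass := d.mass
      spin := d.spin
      mass_pos := d.mass_pos
      abs_spin_le_mass := d.abs_spin_le_mass
      motion := d.motion
      τ₀ := d.τ₀
      chart := fun i ↦ χ ∘ d.chart i
      isLateChart := fun i ↦ isLateChart_comp _ (d.isLateChart i) hχ hχo
      tendsto_truncDeviationCk := fun i R' ↦ (d.tendsto_truncDeviationCk i R').congr fun τ ↦
        (truncDeviationCk_comp (d.background i) hχd hφ (hΨd i) k R' τ).symm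
      exists_pairwise_disjoint := fun R' ↦ by
        obtain ⟨τ₁, hτ₁⟩ := d.exists_pairwise_disjoint R'
        exact ⟨τ₁, pairwise_disjoint_image_comp hinj _ _ hτ₁⟩
      excision := d.excision
      tendsto_excision_div := d.tendsto_excision_div
      flatDomain := d.flatDomain
      setOf_lt_excision_subset_flatDomain := d.setOf_lt_excision_subset_flatDomain
      flatChart := χ ∘ d.flatChart
      isLateChart_flat := isLateChart_comp _ d.isLateChart_flat hχ hχo
      tendsto_deviationCk_flat := d.tendsto_deviationCk_flat.congr fun τ ↦
        (deviationCk_comp (Minkowski.backgroundOn d.flatDomain) hχd hφ hΦd k τ).symm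
      diff_subset_causalPast := by
        have h := image_diff_subset_causalPast_image hχd hτ hφ hinj d.diff_subset_causalPast
        simpa only [image_union, image_iUnion, image_comp] using h }
  refine ⟨d', ?_, ⟨hc1, fun i ϱ τ₂ hϱ hτ₂ ↦ ?_, fun i τ' ϱ hϱ hτ' ↦ ?_, fun y hy ↦ ?_⟩,
    fun τ₂ hτ₂ ↦ ?_, fun τ' hτ' ↦ ?_, fun i ↦ ?_⟩
  · -- the charted region
    simp only [d', FinalStateDecomposition.charted, FinalStateDecomposition.radiationZone,
      FinalStateDecomposition.region, FinalStateDecomposition.background, image_union,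
      image_iUnion, image_comp]
  · -- C2: anchoring at every radius `≥ R₀`
    exact image_comp_subset_causalPast_image_comp hχd hτ hφ (hc2 i ϱ τ₂ hϱ hτ₂)
  · -- C3: relative closedness in `χ O` of the late tube portions
    exact closure_image_comp_inter_image_subset hχo (hc3 i τ' ϱ hϱ hτ')
  · -- C4: the flat chart of `χ_* d` is future oriented
    exact isFutureDirected_mfderiv_comp hχd hτ hφ hΦd (hc4 y hy)
  · -- F1: flat-late points below later flat slabs
    exact image_comp_subset_causalPast_image_comp hχd hτ hφ (hf1 τ₂ hτ₂)
  · -- F2: closures of far flat slabs are flat points (no escape)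
    exact closure_image_comp_subset_of_subset_range hχo (hf2 τ' hτ') (hesc τ' hτ')
  · -- F3: the same late time `T`, the deviation functions being identical
    obtain ⟨T, hT⟩ := hf3 i
    exact ⟨T, supCkENorm_deviationExtend_comp_le (d.background i) hχd hφ (hΨd i) hT⟩

end Summit.FinalStateConjecture.FinalStateConjecture.Theorems.StarvedNecks.SheetBurial

end
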